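/-
Copyright (c) 2026 the pub-hodgecm-mathlib formalisation cell (harness21).  Prover seat hodgecm-mathlib-R90-C10-p04 (g2), SLAB R90-TF, section S1 «Ch. 10∕12 local»,
cell «U4-RAM :182 B_pos» (line (D-1) of R90-C10-p05 (g2), L4 dealer K2E3-plan (g5)): brick (B-4), PART 6 «THE THREE FIBRE LETTERS (K-hi)(K-mid)(K-lo) OF THE MASTER
INTEGRAL» for the U4Keys socket :182 (ramified `χ₁` of positive depth, Branch B) = S1 A2′, crux H413 = `stmt-HodgeConjecture-24833`.  KERNEL module: THEOREMS ONLY (no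
definition, no named fact, no `sorry`, no instance, no notation).  2026-09-05.
-/
import Summits.HodgeConjecture.HodgeConjecture.Theorems.R90S1BposSkewLineFibresByOrthogonality   -- ★ (B-4) PART 4 (this seat): (F<₂) `skewLineIntegral_eq_zero_of_witness_lt`; brings ★ PARTS 1–3
import Summits.HodgeConjecture.HodgeConjecture.Theorems.R90S1BposSkewLineFibreSharpLevel          -- ★ (B-4) PART 5 (this seat): (F<₃) `skewLineIntegral_eq_of_witness_le_of_trivial_lt`
import Summits.HodgeConjecture.HodgeConjecture.Theorems.K2E3LevelNDepthWitnessCover                -- ★ (K2E3-p37): DISCRETENESS `v_le_pow_succ_of_lt_pow` (`|x| < |ϖ|ᵐ ⟹ |x| ≤ |ϖ|ᵐ⁺¹`)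
import HarnessLib

/-!
# R90 · S1 ∕ U4Keys leaf (U4f-χ₁-ram-one-pos), BRANCH B — brick (B-4), PART 6: THE FIBRE LETTERS (K-hi) (K-mid) (K-lo) OF THE MASTER INTEGRAL (B-5)
# `K(a) = ε₀·μ⁻(S⁻₁)` for `|a|_w ≤ |ϖ|^{m+1}`; `K(a) = −ε₀·μ⁻(B⁻_{<1})` for `|a|_w = |ϖ|^m`; `K(a) = 0` for `|ϖ|^m < |a|_w` — `χ₁` of conductor `≤ m+1` with a depth witness at `|ϖ|^m`
# [Keys1984 §4–§5, §7 Thm (2); WeilBNT1967 Ch. II §5; Roche1998 §3–§4; Rogawski1990 §1.10, §12.2 (2)]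

Cell `pub/hodgecm-mathlib` (D-0151), SLAB R90-TF, section S1 «Ch. 10∕12 local», crux H413 = `stmt-HodgeConjecture-24833` (lane `--supports … --as helper`), route of record
`HCCMUnconditional` (no route verbs); prover seat `hodgecm-mathlib-R90-C10-p04` (g2), hand (B-4) of the B_pos line (D-1) led by R90-C10-p05 (g2).  THIS FILE = the three LETTERS
the master integral (B-5) `R90S1BposMasterIntegral.integral_indicator_cutoff_F₀_eq` (p05 (g2), R90 bus 2026-09-04T23:56:07Z; dealer «=» 23:56:30Z) consumes, in the line lead's
EXACT shapes and ★ p862772's conductor letters (`ϖ : L_w`, `hϖ : |ϖ| = exp(−1)`, `hcond` at `|ϖ|^{m+1}`, witness `u₁` at `|ϖ|^m`), as corollaries of PARTS 3–5 (levels by `Valued.v (a w)`):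
THEOREMS ONLY (no `def`, no `instance`, no notation, no named-fact hypothesis, no `sorry`); ★-only imports (no `Lines` import).  NOT THE PAYER of :182.

FRAME: `R := LocalRing L v` at a NON-SPLIT place `v` (`w hw`), `|2|_w = 1` (`h2w`), `σ := conjLocal L c v`, `R⁻ = HeisRing.skewPart σ`, `E r := χ₁(r̂)` if `r` is a unit else `0` (inline
`dite`), `μ⁻ = μY` a regular additive Haar measure on `R⁻`, `K(a) := ∫ y in {y | |(a + y)_w| = 1}, E(a + y) ∂μY` for a `σ`-FIXED `a : R`, `ε₀ := χ₁ δ₀` for a skew unit `δ₀` of absolute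
value one; the Branch-B-inert letter `hfix : ∀ u, (∀ w′, |u_{w′}| = 1) → σu = u → χ₁ u = 1` (= ★ `K2E3KeysThmTwoDepthZeroBranchBConversion.apply_eq_one_of_branchB_of_fixed
(hns hunr χ₁ hB)` at the leaf); `hcond : ∀ u, (∀ w′, |u_{w′} − 1| ≤ |ϖ|^{m+1}) → χ₁ u = 1` (conductor `≤ m + 1`), `u₁` with `|u₁,w′ − 1| ≤ |ϖ|^m` at every `w′` and `χ₁ u₁ ≠ 1`
(the conductor is EXACTLY `m + 1 ≥ 2`).
* (K-hi) **`skewLineIntegral_of_le_pow_succ`** — `|a|_w ≤ |ϖ|^{m+1}` (a = 0 allowed) ⇒ `K(a) = ε₀ · μ⁻{|y|_w = 1}` (PART 3 (F<₁): `χ₁` is trivial at level `|a|` by `hcond`).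
* (K-mid) **`skewLineIntegral_of_eq_pow`** — `|a|_w = |ϖ|^m` ⇒ `K(a) = −(ε₀ · μ⁻{|y|_w < 1})` (PART 5 (F<₃): `u₁` sits AT the level, `χ₁` is trivial strictly below by DISCRETENESS ★
  `v_le_pow_succ_of_lt_pow` + `hcond`).
* (K-lo) **`skewLineIntegral_of_pow_lt`** — `|ϖ|^m < |a|_w` ⇒ `K(a) = 0`: three cases inside — `|a|_w < 1` (PART 4 (F<₂), `u₁` strictly below the level), `|a|_w = 1` (PART 3 (F=), `u₁ ∈
  1 + 𝔪`), `|a|_w > 1` (★ (II)-b3a `skewLineIntegral_eq_zero_of_one_lt_valued`: the region is empty).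
HONEST LABEL.  HC_CM is proved only modulo the 7 printed citations (2 remaining named inputs: hLiu418 = `stmt-HodgeConjecture-24832`, h413 = `stmt-HodgeConjecture-24833`) until rung 0
closes; count-neutral — this file does NOT pay :182 (nor :155); no printed citation is discharged; REL ≠ ★ ≠ BUILT.

## References
* [Keys1984] D. Keys, *Principal series representations of special unitary groups over local fields*, Compositio Math. 51 (1984), §4–§5, §7 Theorem (2) p. 126.
* [WeilBNT1967] A. Weil, *Basic Number Theory* (1967), Ch. I §2–§4, Ch. II §5.
* [Roche1998] A. Roche, *Types and Hecke algebras for principal series representations of split reductive p-adic groups*, Ann. Sci. ÉNS (4) 31 (1998), §3–§4.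
* [Rogawski1990] J. D. Rogawski, *Automorphic Representations of Unitary Groups in Three Variables*, Ann. of Math. Stud. 123 (1990), §1.10 p. 9, §12.2 (2) p. 173.
* [Serre1979] J.-P. Serre, *Local Fields*, GTM 67 (1979), Ch. II §1 (discreteness of the valuation).
-/

set_option autoImplicit false
-- the mandated namespace has the single-problem summit's repeated segment (`HodgeConjecture.HodgeConjecture`)
set_option linter.dupNamespace false

noncomputable section

open NumberField IsDedekindDomain MeasureTheory Measure Topology Set
open scoped NNReal ENNReal
open Literature.NumberTheory Literature.NumberTheory.Automorphic Literature.NumberTheory.Automorphic.UnitaryGroup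

namespace Summit.HodgeConjecture.HodgeConjecture.R90.S1.BposSkewLineFibreLetters

open Summit.HodgeConjecture.HodgeConjecture.Cruxes.H413
open Summit.HodgeConjecture.HodgeConjecture.Cruxes.H413.K2E3BranchBSkewUnitSign
open Summit.HodgeConjecture.HodgeConjecture.Cruxes.H413.K2E3BranchBSkewLineIntegrals
open Summit.HodgeConjecture.HodgeConjecture.R90.S1.BposSkewLineFibresDepth
open Summit.HodgeConjecture.HodgeConjecture.R90.S1.BposSkewLineFibresByOrthogonality
open Summit.HodgeConjecture.HodgeConjecture.R90.S1.BposSkewLineFibreSharpLevel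

variable (L : Type) [Field L] [NumberField L] [IsCMField L] (v : HeightOneSpectrum (𝓞 ↥(maximalRealSubfield L)))
  (w : PlacesOver L v) (hw : IsCMField.complexConj L • w.1 = w.1)

section Letters

variable [MeasurableSpace (LocalRing L v)] [BorelSpace (LocalRing L v)]
  (μY : Measure ↥(HeisRing.skewPart (conjLocal L (IsCMField.complexConj L) v))) [μY.IsAddHaarMeasure] [μY.Regular]

omit [IsCMField L] [MeasurableSpace (LocalRing L v)] [BorelSpace (LocalRing L v)] in
/-- `|ϖ| ≤ 1`, `|ϖ| < 1` and `|ϖ|ᵐ⁺¹ ≤ |ϖ|ᵐ < 1` (`1 ≤ m`) for a uniformiser `|ϖ| = exp(−1)`. [cite: Serre1979, Ch. II §1] -/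
theorem v_uniformizer_pow_facts {ϖ : w.1.adicCompletion L} (hϖ : Valued.v ϖ = WithZero.exp (-1 : ℤ)) {m : ℕ} (hm : 1 ≤ m) :
    Valued.v ϖ ≤ 1 ∧ Valued.v ϖ < 1 ∧ Valued.v ϖ ^ (m + 1) ≤ Valued.v ϖ ^ m ∧ Valued.v ϖ ^ m < 1 := by
  have hvϖ1 : Valued.v ϖ ≤ 1 := by rw [hϖ, ← WithZero.exp_zero, WithZero.exp_le_exp]; norm_num
  have hvϖlt : Valued.v ϖ < 1 := by rw [hϖ, ← WithZero.exp_zero, WithZero.exp_lt_exp]; norm_num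
  refine ⟨hvϖ1, hvϖlt, pow_le_pow_right_of_le_one' hvϖ1 (Nat.le_succ m), ?_⟩
  calc Valued.v ϖ ^ m ≤ Valued.v ϖ ^ 1 := pow_le_pow_right_of_le_one' hvϖ1 hm
    _ < 1 := by rw [pow_one]; exact hvϖlt

open scoped Classical in
include hw in
omit [μY.IsAddHaarMeasure] [μY.Regular] in
/-- **(K-hi) — `|a|_w ≤ |ϖ|^{m+1}` ⇒ `K(a) = ε₀ · μ⁻{|y|_w = 1}`** (a = 0 allowed): the shells of the master integral strictly below the conductor.  PART 3 (F<₁) at level `|a|`: a unit `u`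
with `|(u − 1)_w| ≤ |a|_w ≤ |ϖ|^{m+1}` has `χ₁ u = 1` by `hcond` (one place over `v`). [cite: Keys1984, §4–§5, §7 Theorem (2) p. 126] [cite: WeilBNT1967, Ch. II §5] -/
theorem skewLineIntegral_of_le_pow_succ (h2w : Valued.v (2 : w.1.adicCompletion L) = 1) (χ₁ : (LocalRing L v)ˣ →* ℂˣ)
    (hfix : ∀ u : (LocalRing L v)ˣ, (∀ w' : PlacesOver L v, Valued.v ((u : LocalRing L v) w') = 1) →
      conjLocal L (IsCMField.complexConj L) v (u : LocalRing L v) = u → χ₁ u = 1)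
    (δ₀ : (LocalRing L v)ˣ) (hδσ : conjLocal L (IsCMField.complexConj L) v (δ₀ : LocalRing L v) = -(δ₀ : LocalRing L v)) (hδv : Valued.v ((δ₀ : LocalRing L v) w) = 1)
    {ϖ : w.1.adicCompletion L} (hϖ : Valued.v ϖ = WithZero.exp (-1 : ℤ)) {m : ℕ}
    (hcond : ∀ u : (LocalRing L v)ˣ, (∀ w' : PlacesOver L v, Valued.v (((u : LocalRing L v) w') - 1) ≤ Valued.v ϖ ^ (m + 1)) → χ₁ u = 1)
    {a : LocalRing L v} (ha : conjLocal L (IsCMField.complexConj L) v a = a) (hle : Valued.v (a w) ≤ Valued.v ϖ ^ (m + 1)) :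
    ∫ y in {y : ↥(HeisRing.skewPart (conjLocal L (IsCMField.complexConj L) v)) | Valued.v ((a + (y : LocalRing L v)) w) = 1},
        (fun r : LocalRing L v => if h : IsUnit r then ((χ₁ h.unit : ℂˣ) : ℂ) else 0) (a + (y : LocalRing L v)) ∂μY =
      ((χ₁ δ₀ : ℂˣ) : ℂ) * (μY.real {y : ↥(HeisRing.skewPart (conjLocal L (IsCMField.complexConj L) v)) | Valued.v ((y : LocalRing L v) w) = 1} : ℂ) := by
  have hvϖ1 : Valued.v ϖ ≤ 1 := by rw [hϖ, ← WithZero.exp_zero, WithZero.exp_le_exp]; norm_num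
  have hvϖlt : Valued.v ϖ < 1 := by rw [hϖ, ← WithZero.exp_zero, WithZero.exp_lt_exp]; norm_num
  have hpow : Valued.v ϖ ^ (m + 1) < 1 := by
    rw [pow_succ]; exact lt_of_le_of_lt (mul_le_of_le_one_left' (pow_le_one' hvϖ1 m)) hvϖlt
  have hav : Valued.v (a w) < 1 := lt_of_le_of_lt hle hpow
  have htriv : ∀ u : (LocalRing L v)ˣ, Valued.v (((u : LocalRing L v) - 1) w) ≤ Valued.v (a w) → χ₁ u = 1 := fun u hu =>
    hcond u (forall_placesOver_of_apply L v w hw (show Valued.v (((u : LocalRing L v) w) - 1) ≤ Valued.v ϖ ^ (m + 1) from hu.trans hle))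
  exact skewLineIntegral_eq_of_valued_lt_one_of_trivial L v w hw μY h2w χ₁ hfix δ₀ hδσ hδv ha hav htriv

open scoped Classical in
include hw in
/-- **(K-mid) — `|a|_w = |ϖ|^m` ⇒ `K(a) = −(ε₀ · μ⁻{|y|_w < 1})`**: the shell AT the sharp level `n − 1 = m` of the conductor.  PART 5 (F<₃): the witness `u₁` sits AT the level
(`|u₁ − 1| ≤ |ϖ|^m = |a|`), and `χ₁` is trivial STRICTLY below — `|(u − 1)_w| < |ϖ|^m ⟹ |(u − 1)_w| ≤ |ϖ|^{m+1}` (DISCRETENESS ★ `v_le_pow_succ_of_lt_pow`) `⟹ χ₁ u = 1` (`hcond`).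
[cite: Keys1984, §4–§5, §7 Theorem (2) p. 126] [cite: WeilBNT1967, Ch. II §5] [cite: Serre1979, Ch. II §1] -/
theorem skewLineIntegral_of_eq_pow (h2w : Valued.v (2 : w.1.adicCompletion L) = 1) (χ₁ : (LocalRing L v)ˣ →* ℂˣ) (h₁ : Continuous fun x => ((χ₁ x : ℂˣ) : ℂ))
    (hfix : ∀ u : (LocalRing L v)ˣ, (∀ w' : PlacesOver L v, Valued.v ((u : LocalRing L v) w') = 1) →
      conjLocal L (IsCMField.complexConj L) v (u : LocalRing L v) = u → χ₁ u = 1)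
    (δ₀ : (LocalRing L v)ˣ) (hδσ : conjLocal L (IsCMField.complexConj L) v (δ₀ : LocalRing L v) = -(δ₀ : LocalRing L v)) (hδv : Valued.v ((δ₀ : LocalRing L v) w) = 1)
    {ϖ : w.1.adicCompletion L} (hϖ : Valued.v ϖ = WithZero.exp (-1 : ℤ)) {m : ℕ} (hm : 1 ≤ m)
    (hcond : ∀ u : (LocalRing L v)ˣ, (∀ w' : PlacesOver L v, Valued.v (((u : LocalRing L v) w') - 1) ≤ Valued.v ϖ ^ (m + 1)) → χ₁ u = 1)
    (u₁ : (LocalRing L v)ˣ) (hu₁ : ∀ w' : PlacesOver L v, Valued.v (((u₁ : LocalRing L v) w') - 1) ≤ Valued.v ϖ ^ m) (hχu₁ : χ₁ u₁ ≠ 1)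
    {a : LocalRing L v} (ha : conjLocal L (IsCMField.complexConj L) v a = a) (heq : Valued.v (a w) = Valued.v ϖ ^ m) :
    ∫ y in {y : ↥(HeisRing.skewPart (conjLocal L (IsCMField.complexConj L) v)) | Valued.v ((a + (y : LocalRing L v)) w) = 1},
        (fun r : LocalRing L v => if h : IsUnit r then ((χ₁ h.unit : ℂˣ) : ℂ) else 0) (a + (y : LocalRing L v)) ∂μY =
      -( ((χ₁ δ₀ : ℂˣ) : ℂ) *
          (μY.real {y : ↥(HeisRing.skewPart (conjLocal L (IsCMField.complexConj L) v)) | Valued.v ((y : LocalRing L v) w) < 1} : ℂ) ) := by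
  obtain ⟨-, hvϖlt, -, hpowm⟩ := v_uniformizer_pow_facts L v w hϖ hm
  have hϖ0 : Valued.v ϖ ≠ 0 := by rw [hϖ]; exact WithZero.exp_ne_zero
  have ha0 : Valued.v (a w) ≠ 0 := by rw [heq]; exact pow_ne_zero _ hϖ0
  have hav : Valued.v (a w) < 1 := by rw [heq]; exact hpowm
  have hu₀ : Valued.v (((u₁ : LocalRing L v) - 1) w) ≤ Valued.v (a w) := by rw [heq]; exact hu₁ w
  have htriv : ∀ u : (LocalRing L v)ˣ, Valued.v (((u : LocalRing L v) - 1) w) < Valued.v (a w) → χ₁ u = 1 := fun u hu =>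
    hcond u (forall_placesOver_of_apply L v w hw
      (K2E3LevelNDepthWitnessCover.v_le_pow_succ_of_lt_pow hϖ (show Valued.v (((u : LocalRing L v) w) - 1) < Valued.v ϖ ^ m from heq ▸ hu)))
  exact skewLineIntegral_eq_of_witness_le_of_trivial_lt L v w hw μY h2w χ₁ h₁ hfix δ₀ hδσ hδv ha ha0 hav u₁ hu₀ hχu₁ htriv

open scoped Classical in
include hw in
/-- **(K-lo) — `|ϖ|^m < |a|_w` ⇒ `K(a) = 0`**: every shell strictly above the sharp level.  Three cases inside: `|a|_w < 1` — PART 4 (F<₂) with the witness `u₁` STRICTLY below the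
level (`|u₁ − 1| ≤ |ϖ|^m < |a|`); `|a|_w = 1` — PART 3 (F=) (`u₁ ∈ 1 + 𝔪`, positive depth); `|a|_w > 1` — ★ (II)-b3a `skewLineIntegral_eq_zero_of_one_lt_valued` (empty region).
[cite: Keys1984, §4–§5, §7 Theorem (2) p. 126] [cite: WeilBNT1967, Ch. II §5] -/
theorem skewLineIntegral_of_pow_lt (h2w : Valued.v (2 : w.1.adicCompletion L) = 1) (χ₁ : (LocalRing L v)ˣ →* ℂˣ) (h₁ : Continuous fun x => ((χ₁ x : ℂˣ) : ℂ))
    (hfix : ∀ u : (LocalRing L v)ˣ, (∀ w' : PlacesOver L v, Valued.v ((u : LocalRing L v) w') = 1) →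
      conjLocal L (IsCMField.complexConj L) v (u : LocalRing L v) = u → χ₁ u = 1)
    {ϖ : w.1.adicCompletion L} {m : ℕ}
    (u₁ : (LocalRing L v)ˣ) (hu₁ : ∀ w' : PlacesOver L v, Valued.v (((u₁ : LocalRing L v) w') - 1) ≤ Valued.v ϖ ^ m) (hχu₁ : χ₁ u₁ ≠ 1)
    {a : LocalRing L v} (ha : conjLocal L (IsCMField.complexConj L) v a = a) (hlt : Valued.v ϖ ^ m < Valued.v (a w)) :
    ∫ y in {y : ↥(HeisRing.skewPart (conjLocal L (IsCMField.complexConj L) v)) | Valued.v ((a + (y : LocalRing L v)) w) = 1},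
        (fun r : LocalRing L v => if h : IsUnit r then ((χ₁ h.unit : ℂˣ) : ℂ) else 0) (a + (y : LocalRing L v)) ∂μY = 0 := by
  letI : Invertible (2 : LocalRing L v) := (isUnit_two_localRing L v).invertible
  have hu₀ : Valued.v (((u₁ : LocalRing L v) - 1) w) < Valued.v (a w) := lt_of_le_of_lt (hu₁ w) hlt
  have ha0 : Valued.v (a w) ≠ 0 := (lt_of_le_of_lt _root_.zero_le hlt).ne'
  rcases lt_trichotomy (Valued.v (a w)) 1 with hlt1 | heq1 | hgt1
  · exact skewLineIntegral_eq_zero_of_witness_lt L v w hw μY h2w χ₁ h₁ hfix ha ha0 hlt1 u₁ hu₀ hχu₁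
  · exact skewLineIntegral_eq_zero_of_valued_eq_one_of_posDepth L v w hw μY h2w χ₁ h₁ hfix u₁ (heq1 ▸ hu₀) hχu₁ ha heq1
  · exact skewLineIntegral_eq_zero_of_one_lt_valued L v w hw μY h2w χ₁ ha hgt1

end Letters

end Summit.HodgeConjecture.HodgeConjecture.R90.S1.BposSkewLineFibreLetters

end
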